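import Summits.CriticalPhenomena.PercolationContinuityZ3.Theorems.Transplant.KNLevelsEntrance
import Summits.CriticalPhenomena.PercolationContinuityZ3.Theorems.FK.GibbsOneEdgeEnergy
import Literature.Probability.Percolation.TwoGhostSpace
import HarnessLib

/-!
# N2 / (S0) kit tier — STEP IV′ (forced seed box), form (A) of T4-S0 §10 (O3): every vertex of the FORCED box is a good relay

builds on p205010 (kernel theorem, internal audit signed; external expert review pending) — nothing here uses p205010 and nothing about the node is
claimed.  Lane `prim-bschramm`, seat `prim-hp-8` (gen 37); WAVE 0 (d) file of N2-SCOPE §19, filed after the trigger (lead g10 17:26Z) on the lead's word 17:37:44Z, statements sieved by p5-g14 (form (A) 17:23Z, form (B) 17:35Z).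
Under (S0) (p5-g13 B6 add. A; (R-13) p3-g14) the kit's seed box `B` is FORCED open together with the stem and the column, so Step IV needs no zone, no arm
and no `hU : U ⊆ innerBoundary (Λ n)`: the one probabilistic input is the ROUTE link `h3 : a < P(linkIn Qt B Ft)`.  With the kit-avoidance row
`havoid : wireSet Qt ∩ wireSet S ⊆ wireSet B` (the route region's pairs meet the shell `S ⊇ B` only inside the box) the relays are DETERMINISTIC: for every
configuration `ω` opening all `G`-edges inside `B`, EVERY `u ∈ B` satisfies `a < P_{pin S, ω}(⋃_{t ∈ T} {u ↔ t in Rg})` — by LAST-EXIT MEASURABILITY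
(`determinedBy_linkIn_compl_wireSet`, KNLevelsEntrance; glued with `DeterminedBy.inter_index` of the FK row) the link event does not read the pairs inside `B`, by `havoid` it does not read the other pinned pairs,
and inside the pinned-open box every `u` reaches the path's starting point.  Form (B) (`stepIV_forced_markov`, the package of record per p5-g14's
(O8)/(O9): `havoid` is NOT servable because the bridge prisms are centred): WITHOUT `havoid`, the set of shell patterns on which some box vertex is a bad
relay has probability `≤ δ · P(box open)` — independence of the route link (determined OFF the box's pairs) from the box-open event, then Kozma–Nitzan's
pinned Markov bound `prodBernoulli_real_pinLow_le`. [cite: KozmaNitzan2024, §4 Step IV pp. 24–25] [this work — T4-S0 §4/§10 (O3), p5-g14 (O9) hIV″]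
-/

open MeasureTheory ProbabilityTheory
open scoped ENNReal

namespace Summit.CriticalPhenomena.PercolationContinuityZ3.Theorems

namespace Transplant

namespace KNLevels

open Literature.Probability.Percolation Literature.Probability.LatticeModels SimpleGraph

variable {V : Type*} [DecidableEq V] {G : SimpleGraph V} [G.LocallyFinite]

omit [DecidableEq V] [G.LocallyFinite] in
/-- The inclusion behind both forms: in the cylinder of a configuration opening all `G`-edges inside `B`, the route link from `B` makes EVERY `u ∈ B`
reach `T` inside `Rg`. [folklore] -/
theorem linkIn_inter_localCylinder_subset {S T B Qt Ft : Finset V} (hT : Ft ⊆ T) (hBS : B ⊆ S) {Rg : Set V} (hRB : (↑B : Set V) ⊆ Rg)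
    (hRQ : (↑Qt : Set V) ⊆ Rg) (hconn : ∀ u ∈ B, ∀ v ∈ B, PathIn G (↑B : Set V) u v) {ω : BondConfig V}
    (hω : ∀ c d, c ∈ (↑B : Set V) → d ∈ (↑B : Set V) → G.Adj c d → s(c, d) ∈ ω) {u : V} (hu : u ∈ B) :
    linkIn (↑Qt : Set V) B Ft ∩ localCylinder (wireSet (↑S : Set V)) ω ⊆ ⋃ t ∈ T, openConnIn Rg u t := by
  rintro ω' ⟨hRω', hcyl⟩
  obtain ⟨b, hb, t, ht, hbt⟩ := mem_linkIn_iff.1 hRω'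
  have hopen : ∀ c d, c ∈ (↑B : Set V) → d ∈ (↑B : Set V) → G.Adj c d → s(c, d) ∈ ω' := by
    intro c d hc hd hcd
    have hmem : s(c, d) ∈ wireSet (↑S : Set V) := by
      refine ⟨fun x hx => ?_, by rw [Sym2.mk_isDiag_iff]; exact hcd.ne⟩
      rcases Sym2.mem_iff.1 hx with rfl | rfl
      · exact hBS hc
      · exact hBS hd
    exact (hcyl _ hmem).2 (hω c d hc hd hcd)
  have hub : PathIn (openGraph ω') Rg u b := pathIn_openGraph_of_open hRB hopen (hconn u hu b hb)
  have hbt' : PathIn (openGraph ω') Rg b t := (DCT16.mem_openConnIn_iff_pathIn.1 hbt).mono hRQ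
  exact Set.mem_biUnion (hT ht) (DCT16.mem_openConnIn_iff_pathIn.2 (hub.trans hbt'))

omit [G.LocallyFinite] in
/-- **Step IV′ (forced seed box, deterministic relays).**  Shell `S ⊇ B`, targets `Ft ⊆ T` disjoint from `B`, route region `Qt` and relay region `Rg`
containing `B` and `Qt`, the kit-avoidance row `wireSet Qt ∩ wireSet S ⊆ wireSet B`, `B` connected through `G`-edges inside itself, and the route link
`a < P(linkIn Qt B Ft)`: for every configuration `ω` in which all `G`-edges inside `B` are open, every `u ∈ B` is joined to `T` inside `Rg` with pinned
probability `> a` under the law pinned to `ω` on the pairs of `S`. [cite: KozmaNitzan2024, §4 Step IV pp. 24–25] [this work — T4-S0 §10 (O3)] -/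
theorem stepIV_forced [Countable V] {W : Sym2 V → unitInterval} {S T B Qt Ft : Finset V} (hT : Ft ⊆ T) (hBS : B ⊆ S) (hBF : Disjoint B Ft)
    {Rg : Set V} (hRB : (↑B : Set V) ⊆ Rg) (hRQ : (↑Qt : Set V) ⊆ Rg)
    (havoid : wireSet (↑Qt : Set V) ∩ wireSet (↑S : Set V) ⊆ wireSet (↑B : Set V))
    (hconn : ∀ u ∈ B, ∀ v ∈ B, PathIn G (↑B : Set V) u v)
    {a : ℝ} (h3 : a < (prodBernoulli W).real (linkIn (↑Qt : Set V) B Ft))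
    {ω : BondConfig V} (hω : ∀ c d, c ∈ (↑B : Set V) → d ∈ (↑B : Set V) → G.Adj c d → s(c, d) ∈ ω) :
    ∀ u ∈ B, a < (prodBernoulli (pinW W (wireSet (↑S : Set V)) ω)).real (⋃ t ∈ T, openConnIn Rg u t) := by
  intro u hu
  set F : Finset (Sym2 V) := pairsF S with hF
  have hFS : (↑F : Set (Sym2 V)) = wireSet (↑S : Set V) := coe_pairsF S
  rw [← hFS]
  set μ' := prodBernoulli (pinW W (↑F : Set (Sym2 V)) ω) with hμ'
  set R : Set (BondConfig V) := linkIn (↑Qt : Set V) B Ft with hR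
  -- (1) the route link is determined by the pairs of `Qt` that are not inside `B`
  have hK : DeterminedBy R (wireSet (↑Qt : Set V) ∩ (wireSet (↑B : Set V))ᶜ) :=
    FK.DeterminedBy.inter_index (determinedBy_linkIn (↑Qt : Set V) B Ft subset_rfl) (determinedBy_linkIn_compl_wireSet (↑Qt : Set V) hBF)
  -- (2) those pairs are not pinned
  have hagree : ∀ e ∈ wireSet (↑Qt : Set V) ∩ (wireSet (↑B : Set V))ᶜ, W e = pinW W (↑F : Set (Sym2 V)) ω e := by
    intro e he
    refine (pinW_apply_of_not_mem W ω fun heF => he.2 (havoid ⟨he.1, ?_⟩)).symm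
    rwa [hFS] at heF
  have hRμ : μ'.real R = (prodBernoulli W).real R :=
    (prodBernoulli_real_eq_of_determinedBy W _ hagree hK (measurableSet_linkIn Qt B Ft)).symm
  -- (3) under the pinned law the box is open, so every `u ∈ B` reaches the start of the route path
  have hincl : R ∩ localCylinder (↑F : Set (Sym2 V)) ω ⊆ ⋃ t ∈ T, openConnIn Rg u t := by
    rw [hFS]; exact linkIn_inter_localCylinder_subset hT hBS hRB hRQ hconn hω hu
  calc a < (prodBernoulli W).real R := h3
    _ = μ'.real R := hRμ.symm
    _ = μ'.real (R ∩ localCylinder (↑F : Set (Sym2 V)) ω) :=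
        (prodBernoulli_pinW_real_inter_localCylinder W F.finite_toSet.countable ω R).symm
    _ ≤ μ'.real (⋃ t ∈ T, openConnIn Rg u t) := measureReal_mono hincl (measure_ne_top _ _)

omit [G.LocallyFinite] in
/-- **Step IV′ (forced seed box, Markov form — the package of record).**  Same data as `stepIV_forced` WITHOUT the avoidance row; `E ⊆ wireSet B`
a finite set of pairs containing every `G`-edge inside `B` (the pinned INNER part of the forced seed); a route link of defect `ε`
(`1 − ε ≤ P(linkIn Qt B Ft)`) and a relay gap `η > 0`.  Then the configurations opening `E` on which SOME `u ∈ B` fails to be a relay at level `1 − η`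
(pinned on the pairs of `S`) have probability `≤ (ε/η) · P(E open)`:
`P({E ⊆ ω} ∩ {∃ u ∈ B, P_{pin S, ω}(⋃_{t∈T} {u ↔ t in Rg}) ≤ 1 − η}) ≤ (ε/η) · P{E ⊆ ω}` (the kit reads it at `ε = δ³`, `η = δ`).
[cite: KozmaNitzan2024, §4 Step IV pp. 24–25] [this work — T4-S0 §10 (O3); p5-g14 (O9) hIV″, two-parameter form] -/
theorem stepIV_forced_markov [Countable V] {W : Sym2 V → unitInterval} {S T B Qt Ft : Finset V} (hT : Ft ⊆ T) (hBS : B ⊆ S) (hBF : Disjoint B Ft)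
    {Rg : Set V} (hRB : (↑B : Set V) ⊆ Rg) (hRQ : (↑Qt : Set V) ⊆ Rg) (hconn : ∀ u ∈ B, ∀ v ∈ B, PathIn G (↑B : Set V) u v)
    {E : Finset (Sym2 V)} (hEB : (↑E : Set (Sym2 V)) ⊆ wireSet (↑B : Set V)) (hE : ∀ c d, c ∈ (↑B : Set V) → d ∈ (↑B : Set V) → G.Adj c d → s(c, d) ∈ E)
    {ε η : ℝ} (hη : 0 < η) (h3 : 1 - ε ≤ (prodBernoulli W).real (linkIn (↑Qt : Set V) B Ft)) :
    (prodBernoulli W).real ({ω | (↑E : Set (Sym2 V)) ⊆ ω} ∩ {ω | ∃ u ∈ B,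
      (prodBernoulli (pinW W (wireSet (↑S : Set V)) ω)).real (⋃ t ∈ T, openConnIn Rg u t) ≤ 1 - η}) ≤
      ε / η * (prodBernoulli W).real {ω | (↑E : Set (Sym2 V)) ⊆ ω} := by
  set μ := prodBernoulli W with hμ
  set F : Finset (Sym2 V) := pairsF S with hF
  have hFS : (↑F : Set (Sym2 V)) = wireSet (↑S : Set V) := coe_pairsF S
  set R : Set (BondConfig V) := linkIn (↑Qt : Set V) B Ft with hR
  set Op : Set (BondConfig V) := {ω | (↑E : Set (Sym2 V)) ⊆ ω} with hOp
  set Bad : Set (BondConfig V) := {ω | ∃ u ∈ B,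
      (prodBernoulli (pinW W (wireSet (↑S : Set V)) ω)).real (⋃ t ∈ T, openConnIn Rg u t) ≤ 1 - η} with hBad
  have hRm : MeasurableSet R := measurableSet_linkIn Qt B Ft
  -- `Op` is determined by `E ⊆ wireSet B ⊆ wireSet S`
  have hOpE : DeterminedBy Op (↑E : Set (Sym2 V)) := by
    rw [determinedBy_iff]
    intro ω ω' h
    simp only [hOp, Set.mem_setOf_eq]
    constructor
    · intro hs e he
      have := Set.ext_iff.1 h e
      exact (this.1 ⟨hs he, he⟩).1
    · intro hs e he
      have := Set.ext_iff.1 h e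
      exact (this.2 ⟨hs he, he⟩).1
  have hEF : (↑E : Set (Sym2 V)) ⊆ (↑F : Set (Sym2 V)) := by rw [hFS]; exact hEB.trans fun e he => ⟨fun x hx => hBS (he.1 x hx), he.2⟩
  have hOpF : DeterminedBy Op (↑F : Set (Sym2 V)) := hOpE.mono hEF
  have hOpm : MeasurableSet Op := hOpE.measurableSet_of_finset
  -- independence: `R` is determined OFF the pairs of `B`, `Op` ON pairs inside `B`
  have hRdet : DeterminedBy R (wireSet (↑B : Set V))ᶜ := determinedBy_linkIn_compl_wireSet (↑Qt : Set V) hBF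
  have hdisj : Disjoint (wireSet (↑B : Set V))ᶜ (↑E : Set (Sym2 V)) :=
    Set.disjoint_left.2 fun e he heE => he (hEB heE)
  have hind : μ.real (R ∩ Op) = μ.real R * μ.real Op := by
    simp only [measureReal_def]
    rw [(ProbabilityTheory.Indep_iff _ _ _).1 (prodBernoulli_indep_coordSigma W hdisj) R Op (hRdet.measurableSet_coordSigma hRm)
      (hOpE.measurableSet_coordSigma hOpm), ENNReal.toReal_mul]
  -- Kozma–Nitzan's pinned Markov bound relative to `Op`
  have hMarkov := prodBernoulli_real_pinLow_le W F hRm hOpF η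
  -- the bad set lies in `Op ∩ pinLow R`
  have hsub : Op ∩ Bad ⊆ Op ∩ pinLow W (↑F : Set (Sym2 V)) R η := by
    rintro ω ⟨hωOp, u, hu, hbad⟩
    refine ⟨hωOp, ?_⟩
    rw [mem_pinLow_iff]
    have hω : ∀ c d, c ∈ (↑B : Set V) → d ∈ (↑B : Set V) → G.Adj c d → s(c, d) ∈ ω := fun c d hc hd hcd => hωOp (hE c d hc hd hcd)
    have hincl := linkIn_inter_localCylinder_subset (G := G) hT hBS hRB hRQ hconn hω hu (Qt := Qt) (Ft := Ft)
    rw [← hFS] at hincl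
    calc (prodBernoulli (pinW W (↑F : Set (Sym2 V)) ω)).real R
        = (prodBernoulli (pinW W (↑F : Set (Sym2 V)) ω)).real (R ∩ localCylinder (↑F : Set (Sym2 V)) ω) :=
          (prodBernoulli_pinW_real_inter_localCylinder W F.finite_toSet.countable ω R).symm
      _ ≤ (prodBernoulli (pinW W (↑F : Set (Sym2 V)) ω)).real (⋃ t ∈ T, openConnIn Rg u t) := measureReal_mono hincl (measure_ne_top _ _)
      _ ≤ 1 - η := by rw [hFS]; exact hbad
  -- assemble: `η · P(Op ∩ Bad) ≤ P(Op) − P(R ∩ Op) = P(Op)(1 − P R) ≤ ε · P(Op)`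
  have hOp0 : 0 ≤ μ.real Op := measureReal_nonneg
  have h1 : η * μ.real (Op ∩ Bad) ≤ ε * μ.real Op := by
    calc η * μ.real (Op ∩ Bad)
        ≤ η * μ.real (Op ∩ pinLow W (↑F : Set (Sym2 V)) R η) := mul_le_mul_of_nonneg_left (measureReal_mono hsub (measure_ne_top _ _)) hη.le
      _ ≤ μ.real Op - μ.real (R ∩ Op) := hMarkov
      _ = μ.real Op * (1 - μ.real R) := by rw [hind]; ring
      _ ≤ μ.real Op * ε := mul_le_mul_of_nonneg_left (by linarith) hOp0
      _ = ε * μ.real Op := by ring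
  rw [div_mul_eq_mul_div, le_div_iff₀ hη]
  linarith

end KNLevels

end Transplant

end Summit.CriticalPhenomena.PercolationContinuityZ3.Theorems
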